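import Literature.MathematicalPhysics.PowerSystems.RingMultistability
import HarnessLib

/-!
# A synchronous state at which the potential energy is a transversal strict local MAXIMUM is an
# UNSTABLE synchronous solution, census-free; on a ring the `q`-twisted states with
# `cos(2πq/N) < 0` (`N/4 < |q| ≤ N/2`) are unstable — the converse half of «stable iff |q| < N/4»
# (Wiley–Strogatz–Girvan 2006 twisted states; Manik–Timme–Witthaut 2017 Lemma 1 / §5.4)

Topic `Literature/MathematicalPhysics/PowerSystems`, namespace
`Literature.MathematicalPhysics.PowerSystems.ClassicalModel` (§2 ring) and
`….ClassicalModel.LosslessSystem` (§1, lit-6's record of the lossless network-reduced swing model).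
Companion of `NonMinimumEquilibriumInstability.lean` (gridfusion-lit-1; §3/§4 there: «not a local
minimum + isolation ⇒ unstable», energy route; §11: a positive definite Hesse form ISOLATES the
state, so the stable clause is census-free) and of `RingMultistability.lean` (the `q`-twisted states
of the homogeneous unloaded ring are STABLE synchronous states for `4|q| < N`; its docstring lists
«instability of the states with `4|q| > N`» as not typed). This file supplies that converse.
Everything below is PROVED (no definition, no named fact, no new axiom).

SOURCES (read on the page this session).

* D. Manik, M. Timme, D. Witthaut, Chaos 27 (2017) 083123 [ManikTimmeWitthaut2017] (`lit read
  arxiv:1611.09825`, chunk p0004 L46–L55): **Lemma 1** «… If one of the μ_k < 0, then the dynamical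
  system is linearly unstable» (μ_k the eigenvalues of the Hesse matrix `M(θ*)` of the potential,
  transversal to the rotation `(1,…,1)`); §5.4 (chunk p0012) ring networks.
* A. Mihara, M. Zaks, E. E. N. Macau, R. O. Medrano-T, Phys. Rev. E 105 (2022) L052202
  [MiharaEtAl2022] (`lit read arxiv:2112.10040`, chunk p0005 L56–L95, p0006 L1–L5): the `q`-twisted
  states `Δⱼ = θⱼ − θⱼ₋₁ = 2πq/N`, winding numbers `q = −m,…,m`, `m = N/2`; the eigenvalues (4)
  `γ_ℓ(q) = −4G Σ_{k=1}^R cos(k·2πq/N) sin²(kπℓ/N)`, `ℓ = 1,…,N−1` — for nearest neighbours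
  (`R = 1`) ALL POSITIVE when `cos(2πq/N) < 0` — «the linear stability of these equilibria is
  determined by the eigenvalues … as the ratio decreases, more twisted states (with q ≠ 0) become
  stable [Wiley2006 …]»; «the critical points of V are the q-twisted states and the Lyapunov exponents
  (at critical points) are the eigenvalues γ_ℓ(q)». The primary source D. A. Wiley, S. H. Strogatz,
  M. Girvan, Chaos 16 (2006) 015103 [WileyStrogatzGirvan2006] is paywalled here (acq-13584) and is
  read through this secondary source.
* H.-D. Chiang, IMA 64 (1995) [Chiang1995] §3 Thm 3.1 (global behaviour; tree:
  `LosslessMultimachineDichotomy`) and §6 Thm 6.7 (R1), through the companion file.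

## What is proved

* §1 (any lossless network-reduced system) THE MIRROR OF §11: **`isolated_of_hessForm_negDef`** (any
  number `m` of infinite buses: a NEGATIVE definite Hesse form `Q(θe; v) < 0 ∀ v ≠ 0` isolates the
  solution `θe` of the power-balance equations (2) — §11's convexity argument applied to the system
  with all couplings and injections negated, whose potential is `−U` and whose equilibria are the
  same), **`unstable_rest_of_hessForm_negDef`** (`Mᵢ, Dᵢ > 0`: then `(θe, 0)` is an UNSTABLE rest
  point, `∃ ε ∀ δ`, with no isolation or census hypothesis), and for isolated networks (`m = 0`)
  **`levelIsolated_of_hessForm_negDef_transversal`** (`Q(θe; v) < 0` for every non-constant `v` ⇒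
  `θe` is isolated among the synchronous states ON ITS LEVEL of `Σ Dᵢθᵢ`) and
  **`unstable_syncSolution_of_hessForm_negDef_transversal`** (`n ≥ 2`, `Mᵢ, Dᵢ > 0`: the
  synchronous solution `(θe + ω_s t𝟙, ω_s𝟙)` is UNSTABLE — `∃ ε > 0 ∀ δ > 0 ∃ θ₁` on the leaf with
  `dist(θ₁, θe) < δ`, every motion from `(θ₁, ω_s𝟙)` gets farther than `ε` from it) — Lemma 1's
  «μ_k < 0 ⇒ unstable» in the case ALL transversal `μ_k < 0` (a transversal local maximum), for the
  nonlinear motions and census-free.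
* §2 THE RING: `cos_twisted_lt_zero` (`N < 4|q|`, `2|q| ≤ N` ⇒ `cos(2πq/N) < 0`),
  **`hessForm_twistedState_neg`** (`K > 0`, `cos(2πq/N) < 0`: the Hesse form at the `q`-twisted state
  is `cos(2πq/N)` times the (positive) form at the synchronous state `θ = 0`, hence negative on every
  non-constant direction), ★ **`twistedState_unstable`** (`N = n + 1 ≥ 3` machines, `K > 0`,
  `Mᵢ, Dᵢ > 0`, `cos(2πq/(n+1)) < 0`: the `q`-twisted state is an UNSTABLE synchronous solution of
  the damped swing model on the ring), `twistedState_unstable_of_lt` (the integer window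
  `n + 1 < 4|q|`, `2|q| ≤ n + 1`), and ★★ **`twistedState_stable_or_unstable`** (the classification
  away from the borderline `4|q| = N`: for `2|q| ≤ N`, `4|q| ≠ N`, the `q`-twisted state is a STABLE
  synchronous state if `4|q| < N` and an UNSTABLE synchronous solution if `N < 4|q|`).

DEVIATIONS FROM THE PRINTED SOURCES. WSG2006 / Mihara et al. conclude LINEAR (in)stability of the
twisted states of the first-order ring from the eigenvalues `γ_ℓ(q)`; MTW2017 Lemma 1 concludes
«linearly unstable» from one `μ_k < 0`. Here: the second-order damped swing model, NONLINEAR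
(Lyapunov) instability of the synchronous solution by the energy route of the companion file
(escape of motions released at rest below the energy of the state; Chiang's Thm 3.1 branch), with the
isolation hypothesis DISCHARGED by negative definiteness (§1) — so no census of the ring's synchronous
states (which come in continua through the degenerate states `4|q| = N`) is needed. The borderline
`4|q| = N` (`cos = 0`, zero Hesse form) is not decided.

THREE COLUMNS (LADDER-GRIDFUSION honest framing). CERTIFIED for MODEL `M` = damped lossless
network-reduced swing model (`Mᵢ, Dᵢ > 0`, symmetric couplings; §2: homogeneous unloaded ring,
`P = 0`, uniform `K > 0`; MODEL-VALIDITY MV-1 class — an idealised ring, not a grid record); CLASS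
`C` = initial states `(θ₁, ω_s𝟙)` with `θ₁` on the leaf arbitrarily close to the state. «Unstable»
refers to the synchronous solution of MODEL `M`, never to a grid. NOT CLAIMED: where the escaping
motions go (basins — the subject of WSG2006); the borderline `4|q| = N`; longer-range rings `R ≥ 2`;
anything about a physical system.
-/

noncomputable section

open Real Set Filter Topology Metric Finset

namespace Literature.MathematicalPhysics.PowerSystems

namespace ClassicalModel

/-! ### §1. A (transversally) NEGATIVE definite Hesse form isolates the state and makes it UNSTABLE,
census-free — the mirror of `NonMinimumEquilibriumInstability` §11 -/

namespace LosslessSystem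

section AnyBus

variable {n m : ℕ} (S : LosslessSystem n m)

/-- **A negative definite Hesse form isolates the solution of (2)** (any number `m` of infinite
buses, `C` symmetric): if `Q(θe; v) = ½ΣΣ Cᵢⱼcos(θeᵢ − θeⱼ)(vᵢ − vⱼ)² + ΣΣ Kᵢb cos(θeᵢ − β_b)vᵢ² < 0`
for every `v ≠ 0`, then `θe` is the only solution of the power-balance equations within some
`ρ > 0`. (The system with couplings `−C`, `−K` and injections `−P` has potential `−U`, the same
solutions of (2), and Hesse form `−Q`; apply `isolated_of_hessForm_posDef` to it.)
[cite: ManikTimmeWitthaut2017, §3 Lemma 1 («If one of the μ_k < 0 …»); MiharaEtAl2022, §I («Morse function … the critical points of V are the q-twisted states»)] -/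
theorem isolated_of_hessForm_negDef (hC : ∀ i j, S.C i j = S.C j i) {θe : Fin n → ℝ}
    (he : S.IsEquilibrium θe)
    (hneg : ∀ v : Fin n → ℝ, v ≠ 0 →
      1 / 2 * ∑ i, ∑ j, S.C i j * Real.cos (θe i - θe j) * (v i - v j) ^ 2
        + ∑ i, ∑ b, S.K i b * Real.cos (θe i - S.β b) * v i ^ 2 < 0) :
    ∃ ρ > 0, ∀ θ, S.IsEquilibrium θ → dist θ θe < ρ → θ = θe := by
  set Sn : LosslessSystem n m :=
    { S with C := fun i j => -S.C i j, K := fun i b => -S.K i b, P := fun i => -S.P i } with hSn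
  have hCn : ∀ i j, Sn.C i j = Sn.C j i := fun i j => by
    show -S.C i j = -S.C j i
    rw [hC i j]
  have hflown : ∀ θ i, Sn.flow θ i = -S.flow θ i := fun θ i => by
    show (∑ j, -S.C i j * Real.sin (θ i - θ j)) + ∑ b, -S.K i b * Real.sin (θ i - S.β b)
      = -((∑ j, S.C i j * Real.sin (θ i - θ j)) + ∑ b, S.K i b * Real.sin (θ i - S.β b))
    simp only [neg_mul, Finset.sum_neg_distrib, neg_add]
  have heqv : ∀ θ, S.IsEquilibrium θ ↔ Sn.IsEquilibrium θ := fun θ => by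
    constructor
    · intro h i
      show -S.P i = Sn.flow θ i
      rw [hflown, ← h i]
    · intro h i
      have hi : -S.P i = Sn.flow θ i := h i
      rw [hflown] at hi
      linarith
  have hposn : ∀ v : Fin n → ℝ, v ≠ 0 →
      0 < 1 / 2 * ∑ i, ∑ j, Sn.C i j * Real.cos (θe i - θe j) * (v i - v j) ^ 2
        + ∑ i, ∑ b, Sn.K i b * Real.cos (θe i - Sn.β b) * v i ^ 2 := fun v hv => by
    have h := hneg v hv
    have e : 1 / 2 * ∑ i, ∑ j, Sn.C i j * Real.cos (θe i - θe j) * (v i - v j) ^ 2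
        + ∑ i, ∑ b, Sn.K i b * Real.cos (θe i - Sn.β b) * v i ^ 2
        = -(1 / 2 * ∑ i, ∑ j, S.C i j * Real.cos (θe i - θe j) * (v i - v j) ^ 2
          + ∑ i, ∑ b, S.K i b * Real.cos (θe i - S.β b) * v i ^ 2) := by
      show 1 / 2 * ∑ i, ∑ j, -S.C i j * Real.cos (θe i - θe j) * (v i - v j) ^ 2
          + ∑ i, ∑ b, -S.K i b * Real.cos (θe i - S.β b) * v i ^ 2 = _
      simp only [neg_mul, Finset.sum_neg_distrib]
      ring
    rw [e]
    linarith
  obtain ⟨ρ, hρ, hiso⟩ := Sn.isolated_of_hessForm_posDef hCn ((heqv θe).1 he) hposn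
  exact ⟨ρ, hρ, fun θ hθ hd => hiso θ ((heqv θ).1 hθ) hd⟩

/-- **A negative definite Hesse form ⇒ the rest point `(θe, 0)` is UNSTABLE, census-free** (any
`m`; `Mᵢ, Dᵢ > 0`, `C` symmetric): `∃ ε > 0 ∀ δ > 0` some state within `δ` of `(θe, 0)` has ALL its
forward motions leaving the `ε`-ball around `(θe, 0)` — isolation from `isolated_of_hessForm_negDef`,
the negative direction from any `v ≠ 0` (`n ≥ 1`), then `unstable_of_hessForm_neg` (energy route).
This is Lemma 1's «μ_k < 0 ⇒ unstable» in the case ALL `μ_k < 0` (a strict local maximum of `U`),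
for the nonlinear motions, with no isolation or census hypothesis. THREE COLUMNS: CERTIFIED for
MODEL `M` = damped lossless network-reduced swing model with infinite buses (MV-1), CLASS `C` =
states arbitrarily close to the rest point; «unstable» = the rest point of MODEL `M`.
[cite: ManikTimmeWitthaut2017, §3 Lemma 1; Chiang1995, §3 Thm 3.1 and §6 Thm 6.7 (R1)] -/
theorem unstable_rest_of_hessForm_negDef (hC : ∀ i j, S.C i j = S.C j i) (hM : ∀ i, 0 < S.M i)
    (hD : ∀ i, 0 < S.D i) (hn : 0 < n) {θe : Fin n → ℝ} (he : S.IsEquilibrium θe)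
    (hneg : ∀ v : Fin n → ℝ, v ≠ 0 →
      1 / 2 * ∑ i, ∑ j, S.C i j * Real.cos (θe i - θe j) * (v i - v j) ^ 2
        + ∑ i, ∑ b, S.K i b * Real.cos (θe i - S.β b) * v i ^ 2 < 0) :
    ∃ ε > 0, ∀ δ > 0, ∃ x₁ : (Fin n → ℝ) × (Fin n → ℝ), dist x₁ (θe, 0) < δ ∧
      ∀ X : ℝ → (Fin n → ℝ) × (Fin n → ℝ), X 0 = x₁ →
        (∀ T : ℝ, ∀ t ∈ Icc 0 T, HasDerivWithinAt X (S.field (X t)) (Icc 0 T) t) →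
        ∃ t, 0 ≤ t ∧ ε < dist (X t) (θe, 0) := by
  obtain ⟨ρ, hρ, hiso⟩ := S.isolated_of_hessForm_negDef hC he hneg
  have hv : (fun _ : Fin n => (1 : ℝ)) ≠ 0 := by
    intro h
    have h1 := congrFun h ⟨0, hn⟩
    simp at h1
  exact S.unstable_of_hessForm_neg hC hM hD he hρ hiso (fun _ => 1) (hneg _ hv)

end AnyBus

section NoBus

variable {n : ℕ} (S : LosslessSystem n 0)

/-- **A transversally negative definite Hesse form isolates the synchronous state on its momentum
level** (no infinite bus, `C` symmetric, `Dᵢ > 0`): if `½ΣΣ Cᵢⱼcos(θeᵢ − θeⱼ)(vᵢ − vⱼ)² < 0` for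
every non-constant `v`, then `θe` is the only solution of (2) on its level `Σ Dᵢθᵢ = Σ Dᵢθeᵢ` within
some `ρ > 0` (`levelIsolated_of_hessForm_posDef_transversal` for the system with `−C`, `−P`).
[cite: ManikTimmeWitthaut2017, §3 Lemma 1 («stability transversely to the solution space {θ* + c(1,…,1)}»); MiharaEtAl2022, §I (critical points of the Morse function V)] -/
theorem levelIsolated_of_hessForm_negDef_transversal (hC : ∀ i j, S.C i j = S.C j i)
    (hD : ∀ i, 0 < S.D i) {θe : Fin n → ℝ} (he : S.IsEquilibrium θe)
    (hneg : ∀ v : Fin n → ℝ, (∃ i j, v i ≠ v j) →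
      1 / 2 * ∑ i, ∑ j, S.C i j * Real.cos (θe i - θe j) * (v i - v j) ^ 2 < 0) :
    ∃ ρ > 0, ∀ θ, S.IsEquilibrium θ → ∑ i, S.D i * θ i = ∑ i, S.D i * θe i →
      dist θ θe < ρ → θ = θe := by
  set Sn : LosslessSystem n 0 :=
    { S with C := fun i j => -S.C i j, P := fun i => -S.P i } with hSn
  have hCn : ∀ i j, Sn.C i j = Sn.C j i := fun i j => by
    show -S.C i j = -S.C j i
    rw [hC i j]
  have hflown : ∀ θ i, Sn.flow θ i = -S.flow θ i := fun θ i => by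
    show (∑ j, -S.C i j * Real.sin (θ i - θ j)) + ∑ b : Fin 0, S.K i b * Real.sin (θ i - S.β b)
      = -((∑ j, S.C i j * Real.sin (θ i - θ j)) + ∑ b : Fin 0, S.K i b * Real.sin (θ i - S.β b))
    simp only [neg_mul, Finset.sum_neg_distrib, Finset.univ_eq_empty, Finset.sum_empty, add_zero]
  have heqv : ∀ θ, S.IsEquilibrium θ ↔ Sn.IsEquilibrium θ := fun θ => by
    constructor
    · intro h i
      show -S.P i = Sn.flow θ i
      rw [hflown, ← h i]
    · intro h i
      have hi : -S.P i = Sn.flow θ i := h i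
      rw [hflown] at hi
      linarith
  have hposn : ∀ v : Fin n → ℝ, (∃ i j, v i ≠ v j) →
      0 < 1 / 2 * ∑ i, ∑ j, Sn.C i j * Real.cos (θe i - θe j) * (v i - v j) ^ 2
        + ∑ i, ∑ b, Sn.K i b * Real.cos (θe i - Sn.β b) * v i ^ 2 := fun v hv => by
    have h := hneg v hv
    have e : 1 / 2 * ∑ i, ∑ j, Sn.C i j * Real.cos (θe i - θe j) * (v i - v j) ^ 2
        + ∑ i, ∑ b, Sn.K i b * Real.cos (θe i - Sn.β b) * v i ^ 2
        = -(1 / 2 * ∑ i, ∑ j, S.C i j * Real.cos (θe i - θe j) * (v i - v j) ^ 2) := by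
      show 1 / 2 * ∑ i, ∑ j, -S.C i j * Real.cos (θe i - θe j) * (v i - v j) ^ 2
          + ∑ i, ∑ b : Fin 0, S.K i b * Real.cos (θe i - S.β b) * v i ^ 2 = _
      simp only [neg_mul, Finset.sum_neg_distrib, Finset.univ_eq_empty, Finset.sum_empty,
        Finset.sum_const_zero, add_zero]
      ring
    rw [e]
    linarith
  have hDn : ∀ i, 0 < Sn.D i := hD
  obtain ⟨ρ, hρ, hiso⟩ :=
    Sn.levelIsolated_of_hessForm_posDef_transversal hCn hDn ((heqv θe).1 he) hposn
  exact ⟨ρ, hρ, fun θ hθ hl hd => hiso θ ((heqv θ).1 hθ) hl hd⟩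

/-- **A transversally negative definite Hesse form ⇒ the synchronous solution is UNSTABLE,
census-free** (no infinite bus; at least two machines; `Mᵢ, Dᵢ > 0`, `C` symmetric, any `Σ Pₖ`
with synchronous frequency `ω_s = ΣPₖ/ΣDₖ`). Let `θe` be a synchronous state
(`Pₖ − Dₖω_s = Σⱼ Cₖⱼ sin(θeₖ − θeⱼ)`) at which `½ΣΣ Cᵢⱼcos(θeᵢ − θeⱼ)(vᵢ − vⱼ)² < 0` for every
non-constant `v` (a strict local MAXIMUM of the synchronous-frame potential transversally to the
rotation — Lemma 1's «μ_k < 0» for all `k ≥ 2`). Then `∃ ε > 0 ∀ δ > 0 ∃ θ₁` on the level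
`Σ Dₖθ₁ₖ = Σ Dₖθeₖ` with `dist(θ₁, θe) < δ` such that EVERY forward motion from `(θ₁, ω_s𝟙)` gets
farther than `ε` from the synchronous solution `(θe + ω_s t𝟙, ω_s𝟙)`. Level isolation comes from
the form itself (`levelIsolated_of_hessForm_negDef_transversal`), the non-minimum from any
non-constant direction; then `exists_escape_syncFrame_of_not_isLocalMin`. THREE COLUMNS: CERTIFIED
for MODEL `M` = damped lossless network-reduced swing model without infinite bus (MV-1), CLASS `C` =
states `(θ₁, ω_s𝟙)` with `θ₁` on the leaf arbitrarily close; «unstable» = the synchronous solution of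
MODEL `M`.
[cite: ManikTimmeWitthaut2017, §3 Lemma 1 («If one of the μ_k < 0, then the dynamical system is linearly unstable»); Chiang1995, §3 Thm 3.1 and §6 Thm 6.7 (R1)] -/
theorem unstable_syncSolution_of_hessForm_negDef_transversal (hC : ∀ i j, S.C i j = S.C j i)
    (hM : ∀ i, 0 < S.M i) (hD : ∀ i, 0 < S.D i) (hn : 1 < n) {θe : Fin n → ℝ}
    (he : ∀ k, S.P k - S.D k * ((∑ j, S.P j) / ∑ j, S.D j) = S.flow θe k)
    (hneg : ∀ v : Fin n → ℝ, (∃ i j, v i ≠ v j) →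
      1 / 2 * ∑ i, ∑ j, S.C i j * Real.cos (θe i - θe j) * (v i - v j) ^ 2 < 0) :
    ∃ ε > 0, ∀ δ > 0, ∃ θ₁ : Fin n → ℝ, dist θ₁ θe < δ ∧ ∑ k, S.D k * θ₁ k = ∑ k, S.D k * θe k ∧
      ∀ X : ℝ → (Fin n → ℝ) × (Fin n → ℝ), X 0 = (θ₁, fun _ => (∑ j, S.P j) / ∑ j, S.D j) →
        (∀ T : ℝ, ∀ t ∈ Icc 0 T, HasDerivWithinAt X (S.field (X t)) (Icc 0 T) t) →
        ∃ t, 0 ≤ t ∧ ε < dist (X t)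
          ((fun j => θe j + (∑ j, S.P j) / (∑ j, S.D j) * t), fun _ => (∑ j, S.P j) / ∑ j, S.D j) := by
  set c := (∑ j, S.P j) / ∑ j, S.D j with hc
  set Sc : LosslessSystem n 0 := { S with P := fun i => S.P i - S.D i * c } with hSc
  have hCc : ∀ i j, Sc.C i j = Sc.C j i := hC
  have hec : Sc.IsEquilibrium θe := fun i => he i
  have hnegc : ∀ v : Fin n → ℝ, (∃ i j, v i ≠ v j) →
      1 / 2 * ∑ i, ∑ j, Sc.C i j * Real.cos (θe i - θe j) * (v i - v j) ^ 2 < 0 := hneg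
  -- level isolation from the form itself
  obtain ⟨ρ, hρ, hisoc⟩ := Sc.levelIsolated_of_hessForm_negDef_transversal hCc hD hec hnegc
  have hiso : ∀ θ : Fin n → ℝ, (∀ i, S.P i - S.D i * ((∑ j, S.P j) / ∑ j, S.D j) = S.flow θ i) →
      ∑ i, S.D i * θ i = ∑ i, S.D i * θe i → dist θ θe < ρ → θ = θe :=
    fun θ hθ hl hd => hisoc θ (fun i => hθ i) hl hd
  -- a non-constant direction (two machines) is a negative direction: not a local minimum
  set v₀ : Fin n → ℝ := fun k => if k = ⟨0, by omega⟩ then 1 else 0 with hv₀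
  have hv₀nc : ∃ i j, v₀ i ≠ v₀ j := by
    refine ⟨⟨0, by omega⟩, ⟨1, hn⟩, ?_⟩
    have hne : (⟨1, hn⟩ : Fin n) ≠ ⟨0, by omega⟩ := by
      intro h
      have := congrArg Fin.val h
      simp at this
    simp [hv₀, hne]
  have hmin : ¬ IsLocalMin Sc.potential θe := by
    refine Sc.not_isLocalMin_potential_of_hessForm_neg hCc hec v₀ ?_
    have h := hnegc v₀ hv₀nc
    simpa only [Finset.univ_eq_empty, Finset.sum_empty, Finset.sum_const_zero, add_zero] using h
  refine ⟨ρ / 2, by positivity, fun δ hδ => ?_⟩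
  obtain ⟨θ₁, hd, hl, hesc⟩ :=
    S.exists_escape_syncFrame_of_not_isLocalMin hC hM hD hiso hmin (ε := ρ / 2) (by linarith) hδ
  refine ⟨θ₁, hd, hl, fun X hX0 hX => ?_⟩
  obtain ⟨t, ht, hdist⟩ := hesc X hX0 hX
  exact ⟨t, ht, by rwa [dist_syncFrame_eq] at hdist⟩

end NoBus

end LosslessSystem

/-! ### §2. THE RING: the `q`-twisted states with `cos(2πq/N) < 0` are UNSTABLE synchronous
solutions of the damped swing model (`N/4 < |q| ≤ N/2`) -/

section Ring

variable {n : ℕ} (K : ℝ) (M D : Fin (n + 1) → ℝ) (q : ℤ)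

/-- The integer window: `N < 4|q|` and `2|q| ≤ N` (`N = n + 1`) put `2π|q|/N` in `(π/2, π]`,
where the cosine is negative; `cos(2πq/N) = cos(2π|q|/N)`. [cite: MiharaEtAl2022, §I eq. (4) and the range «q = −m, …, −1, 0, 1, …, m with m = N/2»] -/
theorem cos_twisted_lt_zero (hq : (n : ℤ) + 1 < 4 * |q|) (hq' : 2 * |q| ≤ (n : ℤ) + 1) :
    Real.cos (2 * π * q / (n + 1)) < 0 := by
  have hN : (0 : ℝ) < (n : ℝ) + 1 := by positivity
  have hπ := Real.pi_pos
  have hqR : (n : ℝ) + 1 < 4 * |(q : ℝ)| := by exact_mod_cast hq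
  have hqR' : 2 * |(q : ℝ)| ≤ (n : ℝ) + 1 := by exact_mod_cast hq'
  have hcos : Real.cos (2 * π * q / (n + 1)) = Real.cos (2 * π * |(q : ℝ)| / (n + 1)) := by
    rcases le_or_gt 0 (q : ℝ) with h | h
    · rw [abs_of_nonneg h]
    · rw [abs_of_neg h, show 2 * π * -(q : ℝ) / (n + 1) = -(2 * π * q / (n + 1)) by ring,
        Real.cos_neg]
  rw [hcos]
  refine Real.cos_neg_of_pi_div_two_lt_of_lt ?_ ?_
  · rw [lt_div_iff₀ hN]
    nlinarith
  · rw [div_lt_iff₀ hN]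
    nlinarith

/-- **At a `q`-twisted state with `cos(2πq/N) < 0` the Hesse form is negative on every
non-constant direction** (`K > 0`): all ring edges carry the same residual capacity
`K cos(2πq/N) < 0`, so `Q(θ_q; v) = cos(2πq/N) · ½ΣΣ Cᵢⱼ(vᵢ − vⱼ)²`, and the cycle-Laplacian form
`½ΣΣ Cᵢⱼ(vᵢ − vⱼ)²` (the Hesse form at the in-phase state `θ = 0`) is positive on non-constant `v`
(`hessForm_pos_of_cohesive_of_connected`, the ring is connected). In the words of the sources: all
transversal eigenvalues `μ_k` of `M(θ_q)` are negative / all `γ_ℓ(q) = −4G cos(2πq/N) sin²(πℓ/N)`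
are positive. [cite: MiharaEtAl2022, §I eq. (4) (R = 1); ManikTimmeWitthaut2017, §3 Lemma 1 and §5.4] -/
theorem hessForm_twistedState_neg (hK : 0 < K) (hcos : Real.cos (2 * π * q / (n + 1)) < 0)
    (v : Fin (n + 1) → ℝ) (hv : ∃ i j, v i ≠ v j) :
    1 / 2 * ∑ i, ∑ j, (ringSystem n K M D).C i j
        * Real.cos (twistedState n q i - twistedState n q j) * (v i - v j) ^ 2 < 0 := by
  -- every residual capacity is `cos(2πq/N) · Cᵢⱼ`
  have hw : ∀ i j, (ringSystem n K M D).C i j * Real.cos (twistedState n q i - twistedState n q j)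
      = Real.cos (2 * π * q / (n + 1)) * (ringSystem n K M D).C i j := by
    intro i j
    simp only [ringSystem_C]
    by_cases h : j = finRotate (n + 1) i ∨ i = finRotate (n + 1) j
    · rw [if_pos h]
      rcases h with h | h
      · rw [h, cos_twisted_edge, mul_comm]
      · rw [h, ← Real.cos_neg, neg_sub, cos_twisted_edge, mul_comm]
    · rw [if_neg h, zero_mul, mul_zero]
  have hsum : 1 / 2 * ∑ i, ∑ j, (ringSystem n K M D).C i j
        * Real.cos (twistedState n q i - twistedState n q j) * (v i - v j) ^ 2
      = Real.cos (2 * π * q / (n + 1))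
        * (1 / 2 * ∑ i, ∑ j, (ringSystem n K M D).C i j * (v i - v j) ^ 2) := by
    simp only [hw, Finset.mul_sum]
    refine Finset.sum_congr rfl fun i _ => Finset.sum_congr rfl fun j _ => ?_
    ring
  -- the cycle-Laplacian form is the Hesse form at the in-phase state, positive on non-constant `v`
  have hpos0 := (ringSystem n K M D).hessForm_pos_of_cohesive_of_connected
    (ringSystem_C_nonneg K M D hK.le) (ringSystem_couplingConnected K M D hK)
    (θe := fun _ => (0 : ℝ)) (fun i j _ _ => by rw [sub_self, Real.cos_zero]; exact one_pos) v hv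
  simp only [sub_self, Real.cos_zero, mul_one, Finset.univ_eq_empty, Finset.sum_empty,
    Finset.sum_const_zero, add_zero] at hpos0
  rw [hsum]
  exact mul_neg_of_neg_of_pos hcos hpos0

/-- ★ **THE `q`-TWISTED STATE WITH `cos(2πq/N) < 0` IS AN UNSTABLE SYNCHRONOUS SOLUTION OF THE
DAMPED SWING MODEL ON THE RING** (`N = n + 1 ≥ 3` machines, `K > 0`, `Mᵢ, Dᵢ > 0`): there is
`ε > 0` such that for every `δ > 0` some angle vector `θ₁` on the momentum level of `θ_q`
(`Σ Dₖθ₁ₖ = Σ Dₖθ_qₖ`) with `dist(θ₁, θ_q) < δ` has ALL forward motions of the ring from `(θ₁, 0)`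
getting farther than `ε` from the rest point `(θ_q, 0)` (the ring is unloaded, `ω_s = 0`). No
census of the ring's synchronous states is used: the transversally negative Hesse form isolates
`θ_q` on its level by itself (`unstable_syncSolution_of_hessForm_negDef_transversal`). The converse
half of «`q`-twisted states are stable iff |q| < N/4», for the motions of the second-order model.
THREE COLUMNS: CERTIFIED for MODEL `M` = damped swing model on the homogeneous unloaded ring (MV-1
class), CLASS `C` = rest states `(θ₁, 0)` on the leaf arbitrarily close; «unstable» = the
synchronous solution of MODEL `M`, never a grid.
[cite: WileyStrogatzGirvan2006, (twisted states, linear stability iff |q| < N/4); MiharaEtAl2022, §I eq. (4) and text («the linear stability of these equilibria is determined by the eigenvalues»); ManikTimmeWitthaut2017, §3 Lemma 1 and §5.4] -/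
theorem twistedState_unstable (hn : 2 ≤ n) (hK : 0 < K) (hM : ∀ i, 0 < M i) (hD : ∀ i, 0 < D i)
    (hcos : Real.cos (2 * π * q / (n + 1)) < 0) :
    ∃ ε > 0, ∀ δ > 0, ∃ θ₁ : Fin (n + 1) → ℝ, dist θ₁ (twistedState n q) < δ ∧
      ∑ k, D k * θ₁ k = ∑ k, D k * twistedState n q k ∧
      ∀ X : ℝ → (Fin (n + 1) → ℝ) × (Fin (n + 1) → ℝ), X 0 = (θ₁, 0) →
        (∀ T : ℝ, ∀ t ∈ Icc 0 T,
          HasDerivWithinAt X ((ringSystem n K M D).field (X t)) (Icc 0 T) t) →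
        ∃ t, 0 ≤ t ∧ ε < dist (X t) (twistedState n q, 0) := by
  have h := (ringSystem n K M D).unstable_syncSolution_of_hessForm_negDef_transversal
    (ringSystem_C_symm K M D) hM hD (by omega) (twistedState_isSyncState K M D q hn)
    (hessForm_twistedState_neg K M D q hK hcos)
  have hP : (∑ j, (ringSystem n K M D).P j) / (∑ j, (ringSystem n K M D).D j) = 0 := by
    simp [ringSystem]
  simp only [hP, zero_mul, add_zero] at h
  obtain ⟨ε, hε, hall⟩ := h
  refine ⟨ε, hε, fun δ hδ => ?_⟩
  obtain ⟨θ₁, hd, hl, hesc⟩ := hall δ hδ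
  refine ⟨θ₁, hd, hl, fun X hX0 hX => ?_⟩
  have hX0' : X 0 = (θ₁, fun _ : Fin (n + 1) => (0 : ℝ)) := hX0
  obtain ⟨t, ht, hdist⟩ := hesc X hX0' hX
  exact ⟨t, ht, hdist⟩

/-- **The integer form**: on the ring of `n + 1 ≥ 3` machines (`K > 0`, `Mᵢ, Dᵢ > 0`) every
`q`-twisted state with `n + 1 < 4|q|` and `2|q| ≤ n + 1` is an unstable synchronous solution
(`cos_twisted_lt_zero` + `twistedState_unstable`). [cite: WileyStrogatzGirvan2006, (twisted states unstable for |q| > N/4); MiharaEtAl2022, §I eq. (4); ManikTimmeWitthaut2017, §3 Lemma 1] -/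
theorem twistedState_unstable_of_lt (hn : 2 ≤ n) (hK : 0 < K) (hM : ∀ i, 0 < M i)
    (hD : ∀ i, 0 < D i) (hq : (n : ℤ) + 1 < 4 * |q|) (hq' : 2 * |q| ≤ (n : ℤ) + 1) :
    ∃ ε > 0, ∀ δ > 0, ∃ θ₁ : Fin (n + 1) → ℝ, dist θ₁ (twistedState n q) < δ ∧
      ∑ k, D k * θ₁ k = ∑ k, D k * twistedState n q k ∧
      ∀ X : ℝ → (Fin (n + 1) → ℝ) × (Fin (n + 1) → ℝ), X 0 = (θ₁, 0) →
        (∀ T : ℝ, ∀ t ∈ Icc 0 T,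
          HasDerivWithinAt X ((ringSystem n K M D).field (X t)) (Icc 0 T) t) →
        ∃ t, 0 ≤ t ∧ ε < dist (X t) (twistedState n q, 0) :=
  twistedState_unstable K M D q hn hK hM hD (cos_twisted_lt_zero q hq hq')

/-- ★★ **THE CLASSIFICATION OF THE TWISTED STATES AWAY FROM THE BORDERLINE** (`n + 1 ≥ 3`
machines, `K > 0`, `Mᵢ, Dᵢ > 0`, winding number in the fundamental range `2|q| ≤ n + 1`,
`4|q| ≠ n + 1`): EITHER `4|q| < n + 1` and the `q`-twisted state is a STABLE synchronous state
(every motion from nearby stays nearby and converges to the rotated rest point of its own leaf,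
`twistedState_stable`), OR `n + 1 < 4|q|` and it is an UNSTABLE synchronous solution
(`twistedState_unstable_of_lt`) — «q-twisted states … stable [iff |q| < N/4]», for the motions of
the damped swing model on the ring, both directions, census-free.
[cite: WileyStrogatzGirvan2006, (linear stability of twisted states iff |q| < N/4); MiharaEtAl2022, §I eq. (4) and (i)–(ii); ManikTimmeWitthaut2017, §3 Lemma 1, Cor. 1 and §5.4] -/
theorem twistedState_stable_or_unstable (hn : 2 ≤ n) (hK : 0 < K) (hM : ∀ i, 0 < M i)
    (hD : ∀ i, 0 < D i) (hq' : 2 * |q| ≤ (n : ℤ) + 1) (hqb : 4 * |q| ≠ (n : ℤ) + 1) :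
    (4 * |q| < (n : ℤ) + 1 ∧
      ∀ ε > 0, ∃ δ > 0, ∀ x₁ : (Fin (n + 1) → ℝ) × (Fin (n + 1) → ℝ),
        dist x₁ (twistedState n q, 0) < δ →
        (∃ X : ℝ → (Fin (n + 1) → ℝ) × (Fin (n + 1) → ℝ), X 0 = x₁ ∧
            ∀ T : ℝ, ∀ t ∈ Icc 0 T,
              HasDerivWithinAt X ((ringSystem n K M D).field (X t)) (Icc 0 T) t) ∧
          ∀ X : ℝ → (Fin (n + 1) → ℝ) × (Fin (n + 1) → ℝ), X 0 = x₁ →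
            (∀ T : ℝ, ∀ t ∈ Icc 0 T,
              HasDerivWithinAt X ((ringSystem n K M D).field (X t)) (Icc 0 T) t) →
            (∀ t, 0 ≤ t → dist (X t) (twistedState n q, 0) < ε) ∧
            Tendsto X atTop (𝓝 ((fun j => twistedState n q j +
              (∑ i, (M i * x₁.2 i + D i * (x₁.1 i - twistedState n q i))) / ∑ i, D i), 0))) ∨
    ((n : ℤ) + 1 < 4 * |q| ∧
      ∃ ε > 0, ∀ δ > 0, ∃ θ₁ : Fin (n + 1) → ℝ, dist θ₁ (twistedState n q) < δ ∧
        ∑ k, D k * θ₁ k = ∑ k, D k * twistedState n q k ∧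
        ∀ X : ℝ → (Fin (n + 1) → ℝ) × (Fin (n + 1) → ℝ), X 0 = (θ₁, 0) →
          (∀ T : ℝ, ∀ t ∈ Icc 0 T,
            HasDerivWithinAt X ((ringSystem n K M D).field (X t)) (Icc 0 T) t) →
          ∃ t, 0 ≤ t ∧ ε < dist (X t) (twistedState n q, 0)) := by
  rcases lt_or_gt_of_ne hqb with hlt | hgt
  · exact Or.inl ⟨hlt, fun ε hε => twistedState_stable K M D q hn hK hM hD hlt hε⟩
  · exact Or.inr ⟨hgt, twistedState_unstable_of_lt K M D q hn hK hM hD hgt hq'⟩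

end Ring

end ClassicalModel

end Literature.MathematicalPhysics.PowerSystems

end
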